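import Summits.NavierStokesRegularity.NavierStokesRegularity.Theorems.PerpetualPumpThesisBesovDuhamelBoundBridge
import Summits.NavierStokesRegularity.NavierStokesRegularity.Theorems.PerpetualPumpThesisLocalExistenceOps
import Literature.Analysis.FluidPDE.TaoAveragedEulerFormBound

/-!
# Stub `tameDuhamelBound` for `PerpetualPump.Thesis`, part VIII: `H¹⁰` by duality against `H¹⁰_df`,
# the `H^s × H^{-s}` pairing bound and the parabolic gain `H⁻¹⁰ → H⁻⁹`

Support file (part 8 of the stub `tameDuhamelBound` of line `SketchIdeator2`, crux
stmt-NavierStokesRegularity-1832). Tao's mild formulation (J. Amer. Math. Soc. 29 (2016), (1.15))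
only tests `u(t)` against fields `w ∈ H¹⁰_df`, so the `H¹⁰` norm of `u(t)` is recovered by duality
inside `H¹⁰_df`:

* `FB.enorm_pairing_le`: `|⟨a, b⟩| ≤ ‖a‖_{H^s} ‖b‖_{H^{-s}}` for Tao's bilinear pairing (Parseval,
  Cauchy–Schwarz with the weights `⟨ξ⟩^{±s}`);
* `FB.eFourierSobolevNorm_heat_neg_nine_le`: the **parabolic gain of one derivative**,
  `‖e^{σΔ}w‖_{H⁻⁹} ≤ (1 + σ^{-1/2}) ‖w‖_{H⁻¹⁰}` for `σ > 0` (`⟨ξ⟩e^{-4π²σ|ξ|²} ≤ 1 + σ^{-1/2}`,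
  part Ops of stub `localExistence`);
* `FB.eFourierSobolevNorm_ten_le_of_pairing_bound`: **`H¹⁰` by duality** — if `z ∈ H¹⁰_df` and
  `|⟨z, w⟩| ≤ K ‖w‖_{H⁻¹⁰}` for every `w ∈ H¹⁰_df`, then `‖z‖_{H¹⁰} ≤ K` (tested against the
  truncated Bessel multipliers `min(⟨D⟩²⁰, N) z ∈ H¹⁰_df`, monotone convergence in `N`; the `H¹⁰`
  analogue of the `H⁹` bootstrap of part Space of stub `bilinearOperator`).

## References

* T. Tao, J. Amer. Math. Soc. 29 (2016), 601–674, §1.1 (1.5), (1.15).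
-/

noncomputable section

open MeasureTheory Filter Topology FourierTransform Real Complex
open scoped SchwartzMap ENNReal NNReal FourierTransform ComplexConjugate InnerProductSpace

set_option linter.dupNamespace false

namespace Summit.NavierStokesRegularity.NavierStokesRegularity.Theorems.PerpetualPumpThesis.FB

open Literature.Analysis.FunctionSpaces Literature.Analysis.FluidPDE
  Literature.Analysis.FluidPDE.Tao2016

/-! ### The pairing on `H^s × H^{-s}` -/

/-- The half weights multiply to one: `(1+|ξ|²)^{s/2} (1+|ξ|²)^{-s/2} = 1` in `ℝ≥0∞`. -/
theorem ofReal_halfWeight_mul (s : ℝ) (ξ : EuclideanSpace ℝ (Fin 3)) :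
    ENNReal.ofReal ((1 + ‖ξ‖ ^ 2) ^ (s / 2)) * ENNReal.ofReal ((1 + ‖ξ‖ ^ 2) ^ (-s / 2)) = 1 := by
  have h0 : 0 < 1 + ‖ξ‖ ^ 2 := by positivity
  rw [← ENNReal.ofReal_mul (Real.rpow_nonneg h0.le _), ← Real.rpow_add h0,
    show s / 2 + -s / 2 = 0 by ring, Real.rpow_zero, ENNReal.ofReal_one]

/-- The square of a half weight is the weight: `((1+|ξ|²)^{s/2})² = (1+|ξ|²)^s` in `ℝ≥0∞`. -/
theorem ofReal_halfWeight_sq (s : ℝ) (ξ : EuclideanSpace ℝ (Fin 3)) :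
    ENNReal.ofReal ((1 + ‖ξ‖ ^ 2) ^ (s / 2)) ^ 2 = ENNReal.ofReal ((1 + ‖ξ‖ ^ 2) ^ s) := by
  have h0 : 0 < 1 + ‖ξ‖ ^ 2 := by positivity
  rw [← ENNReal.ofReal_pow (Real.rpow_nonneg h0.le _), ← Real.rpow_natCast,
    ← Real.rpow_mul h0.le]
  norm_num

/-- **The `H^s × H^{-s}` bound for Tao's bilinear pairing**: `|⟨a, b⟩| ≤ ‖a‖_{H^s} ‖b‖_{H^{-s}}` for
all `a, b ∈ L²(ℝ³; ℂ³)` and `s ∈ ℝ` (Parseval `⟨a,b⟩ = ∫ â(ξ)·b̂(-ξ)`, Cauchy–Schwarz with the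
weights `⟨ξ⟩^{±s}`, reflection invariance). Both sides may be infinite. -/
theorem enorm_pairing_le (s : ℝ) (a b : L2C) :
    ‖pairing a b‖ₑ ≤ eFourierSobolevNorm s a * eFourierSobolevNorm (-s) b := by
  set A : EuclideanSpace ℝ (Fin 3) → ℝ≥0∞ := fun ξ => ENNReal.ofReal ((1 + ‖ξ‖ ^ 2) ^ (s / 2)) *
    ‖fourierFn a ξ‖ₑ with hA
  set B : EuclideanSpace ℝ (Fin 3) → ℝ≥0∞ := fun ξ => ENNReal.ofReal ((1 + ‖ξ‖ ^ 2) ^ (-s / 2)) *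
    ‖fourierFn b (-ξ)‖ₑ with hB
  have hAm : AEMeasurable A volume :=
    (measurable_sobolevWeight (s / 2)).aemeasurable.mul (aestronglyMeasurable_fourierFn a).enorm
  have hBm : AEMeasurable B volume := by
    refine (measurable_sobolevWeight (-s / 2)).aemeasurable.mul ?_
    exact ((aestronglyMeasurable_fourierFn b).comp_quasiMeasurePreserving
      (Measure.measurePreserving_neg (volume : Measure (EuclideanSpace ℝ (Fin 3)))).quasiMeasurePreserving).enorm
  rw [FA.pairing_eq_integral_cdot_fourierFn]
  refine (enorm_integral_le_lintegral_enorm _).trans ?_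
  calc ∫⁻ ξ, ‖cdot (fourierFn b (-ξ)) (fourierFn a ξ)‖ₑ
      ≤ ∫⁻ ξ, A ξ * B ξ := by
        refine lintegral_mono fun ξ => ?_
        rw [hA, hB]
        dsimp only
        calc ‖cdot (fourierFn b (-ξ)) (fourierFn a ξ)‖ₑ ≤ ‖fourierFn b (-ξ)‖ₑ * ‖fourierFn a ξ‖ₑ := by
              rw [← ofReal_norm, ← ofReal_norm, ← ofReal_norm, ← ENNReal.ofReal_mul (norm_nonneg _)]
              exact ENNReal.ofReal_le_ofReal (norm_cdot_le _ _)
          _ = (ENNReal.ofReal ((1 + ‖ξ‖ ^ 2) ^ (s / 2)) * ENNReal.ofReal ((1 + ‖ξ‖ ^ 2) ^ (-s / 2))) *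
                (‖fourierFn b (-ξ)‖ₑ * ‖fourierFn a ξ‖ₑ) := by rw [ofReal_halfWeight_mul, one_mul]
          _ = _ := by ring
    _ ≤ (∫⁻ ξ, A ξ ^ (2 : ℝ)) ^ (1 / (2 : ℝ)) * (∫⁻ ξ, B ξ ^ (2 : ℝ)) ^ (1 / (2 : ℝ)) :=
        ENNReal.lintegral_mul_le_Lp_mul_Lq volume Real.HolderConjugate.two_two hAm hBm
    _ = eFourierSobolevNorm s a * eFourierSobolevNorm (-s) b := by
        have hA2 : ∫⁻ ξ, A ξ ^ (2 : ℝ) = ∫⁻ ξ, ENNReal.ofReal ((1 + ‖ξ‖ ^ 2) ^ s) * ‖fourierFn a ξ‖ₑ ^ 2 :=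
          lintegral_congr fun ξ => by
            rw [hA]
            dsimp only
            rw [ENNReal.rpow_two, mul_pow, ofReal_halfWeight_sq]
        have hB2 : ∫⁻ ξ, B ξ ^ (2 : ℝ) =
            ∫⁻ ξ, ENNReal.ofReal ((1 + ‖ξ‖ ^ 2) ^ (-s)) * ‖fourierFn b (-ξ)‖ₑ ^ 2 :=
          lintegral_congr fun ξ => by
            rw [hB]
            dsimp only
            rw [ENNReal.rpow_two, mul_pow, ofReal_halfWeight_sq]
        rw [hA2, hB2, eFourierSobolevNorm_eq, eFourierSobolevNorm_eq,
          ← sobolevWeightIntegral_reflect (-s) (fourierFn b)]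
        rfl

/-! ### The parabolic gain of one derivative -/

/-- **`‖e^{σΔ} w‖_{H⁻⁹} ≤ (1 + σ^{-1/2}) ‖w‖_{H⁻¹⁰}`** for `σ > 0` and every `w ∈ L²(ℝ³; ℂ³)`: the heat
propagator gains one derivative at the parabolic cost `σ^{-1/2}`
(`⟨ξ⟩ e^{-4π²σ|ξ|²} ≤ 1 + σ^{-1/2}`). -/
theorem eFourierSobolevNorm_heat_neg_nine_le {σ : ℝ} (hσ : 0 < σ) (w : L2C) :
    eFourierSobolevNorm (-9) (heat σ w) ≤ ENNReal.ofReal (1 + σ ^ (-(1 / 2 : ℝ))) * eFourierSobolevNorm (-10) w := by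
  have hc0 : (0 : ℝ) ≤ 1 + σ ^ (-(1 / 2 : ℝ)) := by positivity
  rw [eFourierSobolevNorm_eq, eFourierSobolevNorm_eq, sobolevWeightIntegral_congr_ae (fourierFn_heat σ w)]
  have hpt : ∀ ξ : EuclideanSpace ℝ (Fin 3),
      ENNReal.ofReal ((1 + ‖ξ‖ ^ 2) ^ (-9 : ℝ)) * ‖heatSymbol σ ξ • fourierFn w ξ‖ₑ ^ 2 ≤
        ENNReal.ofReal ((1 + σ ^ (-(1 / 2 : ℝ))) ^ 2) *
          (ENNReal.ofReal ((1 + ‖ξ‖ ^ 2) ^ (-10 : ℝ)) * ‖fourierFn w ξ‖ₑ ^ 2) := by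
    intro ξ
    have hρ : (0 : ℝ) < 1 + ‖ξ‖ ^ 2 := by positivity
    have hkey : (1 + ‖ξ‖ ^ 2) ^ (-9 : ℝ) * ‖heatSymbol σ ξ‖ ^ 2 ≤
        (1 + σ ^ (-(1 / 2 : ℝ))) ^ 2 * (1 + ‖ξ‖ ^ 2) ^ (-10 : ℝ) := by
      have h1 := E.norm_pSymbol_le hσ ξ
      rw [norm_mul, Complex.norm_real, Real.norm_of_nonneg (Real.rpow_nonneg hρ.le _)] at h1
      have h2 : ((1 + ‖ξ‖ ^ 2) ^ ((1 : ℝ) / 2) * ‖heatSymbol σ ξ‖) ^ 2 ≤ (1 + σ ^ (-(1 / 2 : ℝ))) ^ 2 :=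
        pow_le_pow_left₀ (by positivity) h1 2
      rw [mul_pow, ← Real.rpow_natCast, ← Real.rpow_mul hρ.le] at h2
      norm_num at h2
      have h3 : (1 + ‖ξ‖ ^ 2) ^ (-9 : ℝ) = (1 + ‖ξ‖ ^ 2) ^ (-10 : ℝ) * (1 + ‖ξ‖ ^ 2) := by
        rw [show (-9 : ℝ) = -10 + 1 by norm_num, Real.rpow_add hρ, Real.rpow_one]
      rw [h3]
      calc (1 + ‖ξ‖ ^ 2) ^ (-10 : ℝ) * (1 + ‖ξ‖ ^ 2) * ‖heatSymbol σ ξ‖ ^ 2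
          = (1 + ‖ξ‖ ^ 2) ^ (-10 : ℝ) * ((1 + ‖ξ‖ ^ 2) * ‖heatSymbol σ ξ‖ ^ 2) := by ring
        _ ≤ (1 + ‖ξ‖ ^ 2) ^ (-10 : ℝ) * (1 + σ ^ (-(1 / 2 : ℝ))) ^ 2 :=
            mul_le_mul_of_nonneg_left h2 (Real.rpow_nonneg hρ.le _)
        _ = _ := by ring
    rw [enorm_smul, mul_pow, ← mul_assoc, ← mul_assoc, ← ofReal_norm (heatSymbol σ ξ),
      ← ENNReal.ofReal_pow (norm_nonneg _), ← ENNReal.ofReal_mul (Real.rpow_nonneg hρ.le _),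
      ← ENNReal.ofReal_mul (sq_nonneg _)]
    exact mul_le_mul' (ENNReal.ofReal_le_ofReal hkey) le_rfl
  unfold sobolevWeightIntegral
  calc (∫⁻ ξ, ENNReal.ofReal ((1 + ‖ξ‖ ^ 2) ^ (-9 : ℝ)) * ‖heatSymbol σ ξ • fourierFn w ξ‖ₑ ^ 2) ^ (1 / 2 : ℝ)
      ≤ (∫⁻ ξ, ENNReal.ofReal ((1 + σ ^ (-(1 / 2 : ℝ))) ^ 2) *
          (ENNReal.ofReal ((1 + ‖ξ‖ ^ 2) ^ (-10 : ℝ)) * ‖fourierFn w ξ‖ₑ ^ 2)) ^ (1 / 2 : ℝ) :=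
        ENNReal.rpow_le_rpow (lintegral_mono hpt) (by norm_num)
    _ = ENNReal.ofReal (1 + σ ^ (-(1 / 2 : ℝ))) *
          (∫⁻ ξ, ENNReal.ofReal ((1 + ‖ξ‖ ^ 2) ^ (-10 : ℝ)) * ‖fourierFn w ξ‖ₑ ^ 2) ^ (1 / 2 : ℝ) := by
        rw [lintegral_const_mul' _ _ ENNReal.ofReal_ne_top, ENNReal.mul_rpow_of_nonneg _ _ (by norm_num),
          ENNReal.ofReal_pow hc0, ← ENNReal.rpow_natCast, ← ENNReal.rpow_mul]
        norm_num

/-! ### `H¹⁰` by duality against `H¹⁰_df` -/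

/-- The truncated weight `min((1+|ξ|²)¹⁰, N)` is continuous. -/
theorem continuous_truncWeight10 (N : ℕ) :
    Continuous fun ξ : EuclideanSpace ℝ (Fin 3) => min ((1 + ‖ξ‖ ^ 2) ^ 10) (N : ℝ) := by
  fun_prop

/-- The truncated weight is nonnegative. -/
theorem truncWeight10_nonneg (N : ℕ) (ξ : EuclideanSpace ℝ (Fin 3)) :
    0 ≤ min ((1 + ‖ξ‖ ^ 2) ^ 10) (N : ℝ) :=
  le_min (by positivity) N.cast_nonneg

/-- The truncated weight, as a complex symbol, is essentially bounded (by `N`). -/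
theorem memLp_top_truncWeight10 (N : ℕ) :
    MemLp (fun ξ : EuclideanSpace ℝ (Fin 3) => ((min ((1 + ‖ξ‖ ^ 2) ^ 10) (N : ℝ) : ℝ) : ℂ)) ∞
      (volume : Measure (EuclideanSpace ℝ (Fin 3))) := by
  refine memLp_top_of_bound (Complex.continuous_ofReal.comp (continuous_truncWeight10 N)).aestronglyMeasurable
    N (Eventually.of_forall fun ξ => ?_)
  simp only [Complex.norm_real, Real.norm_eq_abs, abs_of_nonneg (truncWeight10_nonneg N ξ)]
  exact min_le_right _ _

/-- The truncated Bessel multiplier `J_N = min(⟨D⟩²⁰, N)` obeys the reality condition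
`\overline{m(ξ)} = m(-ξ)` (real, even symbol), a.e. for its `L^∞` class. -/
theorem truncWeight10_reality (N : ℕ) :
    ∀ᵐ ξ ∂(volume : Measure (EuclideanSpace ℝ (Fin 3))),
      conj ((((memLp_top_truncWeight10 N).toLp _ : Lp ℂ ∞ (volume : Measure (EuclideanSpace ℝ (Fin 3)))) :
        EuclideanSpace ℝ (Fin 3) → ℂ) ξ) =
      (((memLp_top_truncWeight10 N).toLp _ : Lp ℂ ∞ (volume : Measure (EuclideanSpace ℝ (Fin 3)))) :
        EuclideanSpace ℝ (Fin 3) → ℂ) (-ξ) := by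
  have h1 := (memLp_top_truncWeight10 N).coeFn_toLp
  have h2 := (Measure.measurePreserving_neg (volume : Measure (EuclideanSpace ℝ (Fin 3)))).quasiMeasurePreserving.ae_eq h1
  filter_upwards [h1, h2] with ξ e1 e2
  simp only [Function.comp_apply] at e2
  rw [e1, e2, norm_neg, Complex.conj_ofReal]

/-- **The truncated `H¹⁰` energy is a pairing**: for a real field `z`,
`‖⟨z, J_N z⟩‖ = I_N = ∫ min((1+|ξ|²)¹⁰, N) |ẑ|²`. -/
theorem enorm_pairing_truncMultiplier10 (N : ℕ) {z : L2C} (hz : IsReal z) :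
    ‖pairing z (fourierMultiplier ((memLp_top_truncWeight10 N).toLp _) z)‖ₑ =
      ∫⁻ ξ, ENNReal.ofReal (min ((1 + ‖ξ‖ ^ 2) ^ 10) (N : ℝ)) * ‖fourierFn z ξ‖ₑ ^ 2 := by
  -- adapted from `B.enorm_inner_truncMultiplier` (part Space of stub `bilinearOperator`), order `10`
  rw [hz.pairing_eq_inner]
  set g : EuclideanSpace ℝ (Fin 3) → ℝ := fun ξ => min ((1 + ‖ξ‖ ^ 2) ^ 10) (N : ℝ) * ‖fourierFn z ξ‖ ^ 2
    with hg
  have hg0 : ∀ ξ, 0 ≤ g ξ := fun ξ => mul_nonneg (truncWeight10_nonneg N ξ) (sq_nonneg _)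
  have hinner : ⟪z, fourierMultiplier ((memLp_top_truncWeight10 N).toLp _) z⟫_ℂ = ((∫ ξ, g ξ : ℝ) : ℂ) := by
    rw [inner_fourierMultiplier_self, ← integral_complex_ofReal]
    refine integral_congr_ae ?_
    filter_upwards [MemLp.coeFn_toLp (memLp_top_truncWeight10 N)] with ξ hξ
    rw [hξ, hg]
    push_cast
    ring
  have hsq : Integrable (fun ξ => ‖fourierFn z ξ‖ ^ 2) (volume : Measure (EuclideanSpace ℝ (Fin 3))) :=
    (memLp_two_iff_integrable_sq_norm (aestronglyMeasurable_fourierFn z)).1 (Lp.memLp (𝓕 z : L2C))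
  have hgm : AEStronglyMeasurable g volume :=
    (continuous_truncWeight10 N).aestronglyMeasurable.mul hsq.1
  have hgi : Integrable g volume := by
    refine (hsq.const_mul (N : ℝ)).mono' hgm (Eventually.of_forall fun ξ => ?_)
    rw [Real.norm_of_nonneg (hg0 ξ), hg]
    exact mul_le_mul_of_nonneg_right (min_le_right _ _) (sq_nonneg _)
  rw [hinner, ← ofReal_norm, Complex.norm_real, Real.norm_of_nonneg (integral_nonneg hg0),
    ofReal_integral_eq_lintegral_ofReal hgi (Eventually.of_forall hg0)]
  refine lintegral_congr fun ξ => ?_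
  rw [hg, ENNReal.ofReal_mul (truncWeight10_nonneg N ξ), ← ofReal_norm (fourierFn z ξ),
    ENNReal.ofReal_pow (norm_nonneg _)]

/-- **The `H⁻¹⁰` norm of `J_N z` is controlled by the truncated energy**: `‖J_N z‖_{H⁻¹⁰} ≤ I_N^{1/2}`
(pointwise `(1+|ξ|²)⁻¹⁰ min((1+|ξ|²)¹⁰,N)² ≤ min((1+|ξ|²)¹⁰,N)`). -/
theorem eFourierSobolevNorm_truncMultiplier10_le (N : ℕ) (z : L2C) :
    eFourierSobolevNorm (-10) (fourierMultiplier ((memLp_top_truncWeight10 N).toLp _) z) ≤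
      (∫⁻ ξ, ENNReal.ofReal (min ((1 + ‖ξ‖ ^ 2) ^ 10) (N : ℝ)) * ‖fourierFn z ξ‖ₑ ^ 2) ^ (1 / 2 : ℝ) := by
  -- adapted from `B.eFourierSobolevNorm_truncMultiplier_le`, order `10`
  rw [eFourierSobolevNorm_eq,
    sobolevWeightIntegral_congr_ae (fourierFn_fourierMultiplier_toLp (memLp_top_truncWeight10 N) z)]
  refine ENNReal.rpow_le_rpow (lintegral_mono fun ξ => ?_) (by norm_num)
  dsimp only
  set m : ℝ := min ((1 + ‖ξ‖ ^ 2) ^ 10) (N : ℝ) with hm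
  have hm0 : 0 ≤ m := truncWeight10_nonneg N ξ
  have hρ : (0 : ℝ) < 1 + ‖ξ‖ ^ 2 := by positivity
  have hkey : (1 + ‖ξ‖ ^ 2) ^ (-10 : ℝ) * m ^ 2 ≤ m := by
    rw [Real.rpow_neg hρ.le, show (10 : ℝ) = ((10 : ℕ) : ℝ) by norm_num, Real.rpow_natCast,
      inv_mul_le_iff₀ (pow_pos hρ 10)]
    calc m ^ 2 = m * m := sq m
      _ ≤ (1 + ‖ξ‖ ^ 2) ^ 10 * m := mul_le_mul_of_nonneg_right (min_le_left _ _) hm0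
  rw [enorm_smul, mul_pow, ← mul_assoc, ← ofReal_norm (((m : ℝ) : ℂ)), Complex.norm_real,
    Real.norm_of_nonneg hm0, ← ENNReal.ofReal_pow hm0, ← ENNReal.ofReal_mul (by positivity)]
  exact mul_le_mul' (ENNReal.ofReal_le_ofReal hkey) le_rfl

/-- **Monotone convergence for the truncated energies**: `‖z‖²_{H¹⁰} = sup_N I_N`. -/
theorem sobolevWeightIntegral_ten_eq_iSup (z : L2C) :
    sobolevWeightIntegral 10 (fourierFn z) =
      ⨆ N : ℕ, ∫⁻ ξ, ENNReal.ofReal (min ((1 + ‖ξ‖ ^ 2) ^ 10) (N : ℝ)) * ‖fourierFn z ξ‖ₑ ^ 2 := by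
  -- adapted from `B.sobolevWeightIntegral_nine_eq_iSup`, order `10`
  have hmeas : ∀ N : ℕ, AEMeasurable
      (fun ξ => ENNReal.ofReal (min ((1 + ‖ξ‖ ^ 2) ^ 10) (N : ℝ)) * ‖fourierFn z ξ‖ₑ ^ 2) volume :=
    fun N => (continuous_truncWeight10 N).measurable.ennreal_ofReal.aemeasurable.mul
      ((aestronglyMeasurable_fourierFn z).enorm.pow_const 2)
  have hmono : ∀ᵐ ξ ∂(volume : Measure (EuclideanSpace ℝ (Fin 3))), Monotone fun N : ℕ =>
      ENNReal.ofReal (min ((1 + ‖ξ‖ ^ 2) ^ 10) (N : ℝ)) * ‖fourierFn z ξ‖ₑ ^ 2 :=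
    Eventually.of_forall fun ξ N M hNM => mul_le_mul'
      (ENNReal.ofReal_le_ofReal (min_le_min_left _ (Nat.cast_le.2 hNM))) le_rfl
  rw [← lintegral_iSup' hmeas hmono]
  unfold sobolevWeightIntegral
  refine lintegral_congr fun ξ => ?_
  rw [← ENNReal.iSup_mul]
  congr 1
  have h10 : ((1 + ‖ξ‖ ^ 2) ^ (10 : ℝ) : ℝ) = (1 + ‖ξ‖ ^ 2) ^ 10 := by
    rw [show (10 : ℝ) = ((10 : ℕ) : ℝ) by norm_num, Real.rpow_natCast]
  rw [h10]
  refine le_antisymm ?_ (iSup_le fun N => ENNReal.ofReal_le_ofReal (min_le_left _ _))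
  refine le_iSup_of_le ⌈(1 + ‖ξ‖ ^ 2) ^ 10⌉₊ (le_of_eq ?_)
  rw [min_eq_left (Nat.le_ceil _)]

/-- **`H¹⁰` by duality against `H¹⁰_df`.** If `z ∈ H¹⁰_df` and `|⟨z, w⟩| ≤ K ‖w‖_{H⁻¹⁰}` for every
`w ∈ H¹⁰_df`, then `‖z‖_{H¹⁰} ≤ K` (the test fields `J_N z = min(⟨D⟩²⁰, N) z` lie in `H¹⁰_df`:
real even bounded symbol). -/
theorem eFourierSobolevNorm_ten_le_of_pairing_bound {z : L2C} (hz : MemH10df z) {K : ℝ≥0∞}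
    (h : ∀ w : L2C, MemH10df w → ‖pairing z w‖ₑ ≤ K * eFourierSobolevNorm (-10) w) :
    eFourierSobolevNorm 10 z ≤ K := by
  -- adapted from `B.eFourierSobolevNorm_nine_le_of_inner_bound`, order `10`, bilinear pairing
  have hI : ∀ N : ℕ,
      ∫⁻ ξ, ENNReal.ofReal (min ((1 + ‖ξ‖ ^ 2) ^ 10) (N : ℝ)) * ‖fourierFn z ξ‖ₑ ^ 2 ≤ K ^ 2 := by
    intro N
    set I : ℝ≥0∞ := ∫⁻ ξ, ENNReal.ofReal (min ((1 + ‖ξ‖ ^ 2) ^ 10) (N : ℝ)) * ‖fourierFn z ξ‖ₑ ^ 2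
      with hIdef
    set J : L2C := fourierMultiplier ((memLp_top_truncWeight10 N).toLp _) z with hJ
    have hJmem : MemH10df J := hz.fourierMultiplier_of_ae _ (truncWeight10_reality N)
    have hItop : I ≠ ∞ := by
      have h2 : ∫⁻ ξ, ‖fourierFn z ξ‖ₑ ^ 2 = ‖z‖ₑ ^ 2 := by
        rw [← lintegral_enorm_sq_fourierFn_rpow_eq z, ← ENNReal.rpow_natCast, ← ENNReal.rpow_mul]
        norm_num
      have hle : I ≤ (N : ℝ≥0∞) * ‖z‖ₑ ^ 2 := by
        rw [hIdef, ← h2, ← lintegral_const_mul' _ _ (ENNReal.natCast_ne_top N)]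
        refine lintegral_mono fun ξ => mul_le_mul' ?_ le_rfl
        calc ENNReal.ofReal (min ((1 + ‖ξ‖ ^ 2) ^ 10) (N : ℝ)) ≤ ENNReal.ofReal (N : ℝ) :=
              ENNReal.ofReal_le_ofReal (min_le_right _ _)
          _ = (N : ℝ≥0∞) := ENNReal.ofReal_natCast N
      exact (hle.trans_lt (ENNReal.mul_lt_top (ENNReal.natCast_lt_top N)
        (ENNReal.pow_lt_top enorm_lt_top))).ne
    have h1 : I ≤ K * I ^ (1 / 2 : ℝ) :=
      calc I = ‖pairing z J‖ₑ := (enorm_pairing_truncMultiplier10 N hz.2.1).symm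
        _ ≤ K * eFourierSobolevNorm (-10) J := h J hJmem
        _ ≤ K * I ^ (1 / 2 : ℝ) := mul_le_mul' le_rfl (eFourierSobolevNorm_truncMultiplier10_le N z)
    by_cases hI0 : I = 0
    · rw [hI0]; exact zero_le
    have hs0 : I ^ (1 / 2 : ℝ) ≠ 0 := by
      intro h0
      rcases ENNReal.rpow_eq_zero_iff.1 h0 with ⟨h0', _⟩ | ⟨_, h0'⟩
      · exact hI0 h0'
      · norm_num at h0'
    have hstop : I ^ (1 / 2 : ℝ) ≠ ∞ := ENNReal.rpow_ne_top_of_nonneg (by norm_num) hItop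
    have hII : I = I ^ (1 / 2 : ℝ) * I ^ (1 / 2 : ℝ) := by
      rw [← ENNReal.rpow_add _ _ hI0 hItop]; norm_num
    have hsK : I ^ (1 / 2 : ℝ) ≤ K := by
      refine (ENNReal.mul_le_mul_iff_left hs0 hstop).1 ?_
      calc I ^ (1 / 2 : ℝ) * I ^ (1 / 2 : ℝ) = I := hII.symm
        _ ≤ K * I ^ (1 / 2 : ℝ) := h1
    calc I = (I ^ (1 / 2 : ℝ)) ^ 2 := by
          rw [← ENNReal.rpow_natCast, ← ENNReal.rpow_mul]; norm_num
      _ ≤ K ^ 2 := by gcongr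
  rw [eFourierSobolevNorm_eq, sobolevWeightIntegral_ten_eq_iSup]
  calc (⨆ N : ℕ, ∫⁻ ξ, ENNReal.ofReal (min ((1 + ‖ξ‖ ^ 2) ^ 10) (N : ℝ)) * ‖fourierFn z ξ‖ₑ ^ 2) ^
        (1 / 2 : ℝ) ≤ (K ^ 2) ^ (1 / 2 : ℝ) := ENNReal.rpow_le_rpow (iSup_le hI) (by norm_num)
    _ = K := by rw [← ENNReal.rpow_natCast, ← ENNReal.rpow_mul]; norm_num

end Summit.NavierStokesRegularity.NavierStokesRegularity.Theorems.PerpetualPumpThesis.FB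

namespace Summit.NavierStokesRegularity.NavierStokesRegularity.Theorems.PerpetualPumpThesis

open Literature.Analysis.FluidPDE Literature.Analysis.FluidPDE.Tao2016
open Literature.Analysis.FunctionSpaces

/-- **Part Duality of stub `tameDuhamelBound` (registered sub-goal `stub_FB_Duality`)**: `H¹⁰` by
duality inside `H¹⁰_df` — if `z ∈ H¹⁰_df` and `|⟨z, w⟩| ≤ K ‖w‖_{H⁻¹⁰}` for every `w ∈ H¹⁰_df`
(Tao's bilinear pairing), then `‖z‖_{H¹⁰} ≤ K`; the device through which the mild formulation
(1.15), which only tests against `H¹⁰_df`, yields `H¹⁰` bounds in line `SketchIdeator2`. -/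
theorem stub_FB_Duality : ∀ (z : L2C) (K : ENNReal), MemH10df z → (∀ w : L2C, MemH10df w → ‖pairing z w‖ₑ ≤ K * eFourierSobolevNorm (-10) w) → eFourierSobolevNorm 10 z ≤ K :=
  fun _ _ hz h => FB.eFourierSobolevNorm_ten_le_of_pairing_bound hz h

end Summit.NavierStokesRegularity.NavierStokesRegularity.Theorems.PerpetualPumpThesis
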